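import Summits.MatrixMultiplication.MatrixMultiplication.Theses.TetrahedronCarving
import Summits.MatrixMultiplication.MatrixMultiplication.Theorems.TetrahedronTensorRectangular
import Literature.Computability.AlgebraicComplexity.TensorRankFactsProofs
import Literature.Computability.AlgebraicComplexity.UnitTensorMomentPolytopeProofs
import HarnessLib

/-!
# Tetrahedron tensor — universal one-leg collapse: `⟨n,n,n⟩ ⊠ W ≤ T(K₄)_n` for EVERY `W`

Decomp-mm lens 6, g29, door D2 (a NON-body input beneath the residual `TetraPlusTwo :
ω + 2 ≤ ω(K₄)` of the cut of record `closes (TetraExcessZero) (TetraPlusTwo)`).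

**Collapse certificates.** Apply an arbitrary linear map to ONE leg of the 4-tensor `T(K₄)_n`
(leg `3`, the vertex seeing the edges `03, 13, 23`) and read the result as a 3-tensor whose third
leg is (vertex `2`) × (the image index `z : Z`).  Every 3-tensor so obtained is a Kronecker product
`⟨n,n,n⟩ ⊠ W` of the matrix multiplication tensor of the triangle `012` with a 3-tensor
`W : [n] × [n] × ([n] × Z)` read off the map (legs = the labels of the edges `03, 13, (23, z)`), and
EVERY such `W` occurs.  A 4-party rank-one decomposition collapses to a 3-party one, so

* `tensorRank_kronecker_le_tensorRankD_tetra : R(⟨n,n,n⟩ ⊠ W) ≤ R₄(T(K₄)_n)` for every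
  `W : Fin n → Fin n → Fin n × Z → F` (universal restriction), and the plain cubic case
  `tensorRank_kronecker_cube_le_tensorRankD_tetra` (`W : Fin n → Fin n → Fin n → F`);
* instances: `W = ⟨n⟩` (the `n`-fold direct sum of `⟨n,n,n⟩`, `tensorRank_kronecker_unit_le`),
  `W = ⟨1,n,n⟩` (recovers the grouping certificate `⟨n, n², n²⟩ ≤ T(K₄)_n` of
  `TetrahedronTensorRectangular.lean` as ONE collapse, `tensorRank_matMulTensor_one_le_tensorRankD_tetra`);
* the CEILING `tensorRank_kronecker_le_ceiling : R(⟨n,n,n⟩ ⊠ W) ≤ R(⟨n,n,n⟩) · n²` (Bläser 2013,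
  Lemma 5.8, and the slicing bound `R(W) ≤ n²`): in exponents a collapse certificate certifies at
  most `ω + 2` — exactly the residual.  So `TetraPlusTwo` reads: *the collapse ceiling is attained*,
  `sup_W R(⟨n,n,n⟩ ⊠ W_n) = n^{ω+2-o(1)}` would imply it, and the grouping/flattening certificates
  (`TetraResidualGroupingCeiling.lean`, all `≤ max(4, ω(2,1,2))`) are the collapses with `W` itself a
  matrix multiplication tensor.  The free choice of `W_n` (a tensor of format `n`, not a fixed tensor
  and not a point of the asymptotic spectrum) is what leaves the body semantics of the g27/g28
  necessity no-go (`TetraResidualNecessity*.lean`); the price is a superlinear rank lower bound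
  (`n^{4}` on format `n³` already under `ω = 2`), for which no technique is known — recorded as a
  door, not as a crux.

Sorry-free; elementary index bookkeeping over a field.
-/

noncomputable section

set_option linter.dupNamespace false

namespace Summit.MatrixMultiplication.MatrixMultiplication.Theorems.TetrahedronTensor

open Literature.Computability.AlgebraicComplexity

/-! ## The collapse point and its value -/

section Collapse

variable {F : Type*} [Field F]

/-- The four label triples of the collapse point: vertex `0` sees `(e₀₁,e₀₂,e₀₃) = (a.1.1,a.1.2,a.2)`,
vertex `1` sees `(e₀₁,e₁₂,e₁₃) = (b.1.1,b.1.2,b.2)`, vertex `2` sees `(e₀₂,e₁₂,e₂₃) = (c.2,c.1,z)`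
(the third leg of `⟨n,n,n⟩` lists `(e₁₂,e₀₂)`), vertex `3` sees `d = (e₀₃,e₁₃,e₂₃)`. -/
def collapseLabels {n : ℕ} (a b : (Fin n × Fin n) × Fin n) (c : Fin n × Fin n) (z : Fin n)
    (d : Fin n × Fin n × Fin n) : Fin 4 → Fin 3 → Fin n :=
  ![![a.1.1, a.1.2, a.2], ![b.1.1, b.1.2, b.2], ![c.2, c.1, z], ![d.1, d.2.1, d.2.2]]

/-- The leg indices of the collapse point. -/
def collapsePoint {n : ℕ} (a b : (Fin n × Fin n) × Fin n) (c : Fin n × Fin n) (z : Fin n)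
    (d : Fin n × Fin n × Fin n) : Fin 4 → Fin (n ^ 3) :=
  fun v => enc (collapseLabels a b c z d v 0) (collapseLabels a b c z d v 1)
    (collapseLabels a b c z d v 2)

/-- **Value of `T(K₄)_n` at a collapse point**: the triangle `012` must be consistent (the matrix
multiplication pattern `⟨n,n,n⟩(a.1, b.1, c)`) and vertex `3` must see `d = (a.2, b.2, z)`.
[folklore] -/
theorem tetra_collapsePoint {n : ℕ} (a b : (Fin n × Fin n) × Fin n) (c : Fin n × Fin n) (z : Fin n)
    (d : Fin n × Fin n × Fin n) :
    tetra F n (collapsePoint a b c z d) =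
      if (a.1.1 = b.1.1 ∧ b.1.2 = c.1 ∧ a.1.2 = c.2) ∧ (a.2 = d.1 ∧ b.2 = d.2.1 ∧ z = d.2.2)
        then 1 else 0 := by
  unfold collapsePoint
  rw [tetra_apply_enc]
  refine if_congr ?_ rfl rfl
  simp only [consistent_iff, collapseLabels, Matrix.cons_val_zero, Matrix.cons_val_one,
    Matrix.cons_val_two, Matrix.cons_val_three, Matrix.head_cons, Matrix.tail_cons]
  tauto

/-- **The collapse identity**: `⟨n,n,n⟩ ⊠ W` at `(a, b, (c, (z, j)))` is the weighted sum over the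
labels `d` of vertex `3` of `T(K₄)_n` at the collapse points, with weights `W d (·, j)`.
[folklore] -/
theorem kronecker_eq_sum_tetra {n : ℕ} {Z : Type*} (W : Fin n → Fin n → Fin n × Z → F)
    (a b : (Fin n × Fin n) × Fin n) (c : (Fin n × Fin n) × (Fin n × Z)) :
    kroneckerTensor (matMulTensor F n n n) W a b c =
      ∑ d : Fin n × Fin n × Fin n, W d.1 d.2.1 (d.2.2, c.2.2) *
        tetra F n (collapsePoint a b c.1 c.2.1 d) := by
  simp_rw [tetra_collapsePoint]
  rw [Finset.sum_eq_single (a.2, b.2, c.2.1)]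
  · rw [kroneckerTensor_apply]
    simp only [matMulTensor, and_true, Prod.mk.eta]
    ring
  · intro d _ hd
    rw [if_neg, mul_zero]
    rintro ⟨-, h₁, h₂, h₃⟩
    exact hd (Prod.ext h₁.symm (Prod.ext h₂.symm h₃.symm))
  · intro h
    exact absurd (Finset.mem_univ _) h

/-! ## Universal restriction `R(⟨n,n,n⟩ ⊠ W) ≤ R₄(T(K₄)_n)` -/

/-- **Universal one-leg collapse.** For EVERY weight tensor `W : [n] × [n] × ([n] × Z)` the
Kronecker product `⟨n,n,n⟩ ⊠ W` is a restriction of `T(K₄)_n` (a linear map on leg `3`, then leg `3`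
read into the third party), hence `R(⟨n,n,n⟩ ⊠ W) ≤ R₄(T(K₄)_n)`: a rank-one decomposition
`T(K₄)_n = ∑_t ⊗_v u_t(v)` collapses to the triads
`u_t(0) ⊗ u_t(1) ⊗ (u_t(2) · ⟨W(·,j), u_t(3)⟩)`. [folklore] -/
theorem tensorRank_kronecker_le_tensorRankD_tetra (n : ℕ) {Z : Type*}
    (W : Fin n → Fin n → Fin n × Z → F) :
    tensorRank (kroneckerTensor (matMulTensor F n n n) W) ≤ tensorRankD (tetra F n) := by
  classical
  obtain ⟨u, hu⟩ := exists_rankOne_decomposition_tetra (F := F) n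
  refine tensorRank_le_of_eq_sum
    (fun t (a : (Fin n × Fin n) × Fin n) => u t 0 (enc a.1.1 a.1.2 a.2))
    (fun t (b : (Fin n × Fin n) × Fin n) => u t 1 (enc b.1.1 b.1.2 b.2))
    (fun t (c : (Fin n × Fin n) × (Fin n × Z)) => u t 2 (enc c.1.2 c.1.1 c.2.1) *
      ∑ d : Fin n × Fin n × Fin n, W d.1 d.2.1 (d.2.2, c.2.2) * u t 3 (enc d.1 d.2.1 d.2.2)) ?_
  funext a b c
  rw [kronecker_eq_sum_tetra, sum_triad_apply]
  have hpt : ∀ d : Fin n × Fin n × Fin n, tetra F n (collapsePoint a b c.1 c.2.1 d) =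
      ∑ t, u t 0 (enc a.1.1 a.1.2 a.2) * u t 1 (enc b.1.1 b.1.2 b.2) *
        u t 2 (enc c.1.2 c.1.1 c.2.1) * u t 3 (enc d.1 d.2.1 d.2.2) := by
    intro d
    have h := congrFun hu (collapsePoint a b c.1 c.2.1 d)
    rw [Finset.sum_apply] at h
    rw [← h]
    refine Finset.sum_congr rfl fun t _ => ?_
    rw [rankOneTensor_apply, Fin.prod_univ_four]
    simp only [collapsePoint, collapseLabels, Matrix.cons_val_zero, Matrix.cons_val_one,
      Matrix.cons_val_two, Matrix.cons_val_three, Matrix.head_cons, Matrix.tail_cons]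
  simp_rw [hpt, Finset.mul_sum]
  rw [Finset.sum_comm]
  exact Finset.sum_congr rfl fun t _ => Finset.sum_congr rfl fun d _ => by ring

/-- **Universal collapse, cubic weights**: `R(⟨n,n,n⟩ ⊠ W) ≤ R₄(T(K₄)_n)` for every
`W : Fin n → Fin n → Fin n → F` (the case `Z = Fin 1`, by restriction along `c ↦ (c, 0)`).
[folklore] -/
theorem tensorRank_kronecker_cube_le_tensorRankD_tetra (n : ℕ) (W : Fin n → Fin n → Fin n → F) :
    tensorRank (kroneckerTensor (matMulTensor F n n n) W) ≤ tensorRankD (tetra F n) := by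
  let W' : Fin n → Fin n → Fin n × Fin 1 → F := fun x y zc => W x y zc.1
  have h := tensorRank_precomp_le (kroneckerTensor (matMulTensor F n n n) W') id id
    (fun c : (Fin n × Fin n) × Fin n => (c.1, (c.2, (0 : Fin 1))))
  have e : (fun a b c => kroneckerTensor (matMulTensor F n n n) W' (id a) (id b)
      (c.1, (c.2, (0 : Fin 1)))) = kroneckerTensor (matMulTensor F n n n) W := by
    funext a b c
    simp only [kroneckerTensor_apply, id, W']
  rw [e] at h
  exact h.trans (tensorRank_kronecker_le_tensorRankD_tetra n W')

/-! ## Instances: direct sums and the grouping certificate are collapses -/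

/-- `W = ⟨n⟩`: the Kronecker product `⟨n,n,n⟩ ⊠ ⟨n⟩` (the `n`-fold direct sum of `⟨n,n,n⟩`) is a
collapse of `T(K₄)_n`. [folklore] -/
theorem tensorRank_kronecker_unit_le (n : ℕ) :
    tensorRank (kroneckerTensor (matMulTensor F n n n) (unitTensor F n)) ≤ tensorRankD (tetra F n) :=
  tensorRank_kronecker_cube_le_tensorRankD_tetra n _

/-- `W = ⟨1,n,n⟩`: the grouping certificate is ONE collapse — `⟨n,n,n⟩ ⊠ ⟨1,n,n⟩ ≅ ⟨n, n², n²⟩`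
(matrix tensors multiply, Bläser 2013 p. 24), so `R(⟨n·1, n·n, n·n⟩) ≤ R₄(T(K₄)_n)`; compare
`tensorRank_matMulTensor_le_tensorRankD_tetra : R(⟨N², N, N²⟩) ≤ R₄(T(K₄)_N)` of
`TetrahedronTensorRectangular.lean` (the same bound up to a cyclic rotation of `⟨·,·,·⟩`).
[cite: Blaser2013, Lemma 5.8 and p. 24] -/
theorem tensorRank_matMulTensor_one_le_tensorRankD_tetra (n : ℕ) :
    tensorRank (matMulTensor F (n * 1) (n * n) (n * n)) ≤ tensorRankD (tetra F n) := by
  -- `⟨n·1, n·n, n·n⟩ ≅ ⟨n,n,n⟩ ⊠ ⟨1,n,n⟩` (double indices)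
  have h₁ := tensorRank_reindex (doubleIndexEquiv n n 1 n) (doubleIndexEquiv n n 1 n)
    (doubleIndexEquiv n n n n) (matMulTensor F (n * 1) (n * n) (n * n))
  have e₁ : (fun a b c => matMulTensor F (n * 1) (n * n) (n * n) (doubleIndexEquiv n n 1 n a)
      (doubleIndexEquiv n n 1 n b) (doubleIndexEquiv n n n n c)) =
      kroneckerTensor (matMulTensor F n n n) (matMulTensor F 1 n n) := by
    funext a b c
    rw [kroneckerTensor_matMulTensor]
  rw [e₁] at h₁
  rw [← h₁]
  -- `⟨1,n,n⟩` on legs `Fin 1 × Fin n, Fin 1 × Fin n, Fin n × Fin n` is the weight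
  -- `W x y (z, j) = [x = y] [y = ?]…`: reindex the first two weight legs by `Fin 1 × Fin n ≃ Fin n`.
  let e : Fin 1 × Fin n ≃ Fin n := (Equiv.uniqueProd (Fin n) (Fin 1))
  let W : Fin n → Fin n → Fin n × Fin n → F :=
    fun x y c => matMulTensor F 1 n n (e.symm x) (e.symm y) c
  have h₂ := tensorRank_reindex ((Equiv.refl (Fin n × Fin n)).prodCongr e)
    ((Equiv.refl (Fin n × Fin n)).prodCongr e) (Equiv.refl ((Fin n × Fin n) × (Fin n × Fin n)))
    (kroneckerTensor (matMulTensor F n n n) W)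
  have e₂ : (fun a b c => kroneckerTensor (matMulTensor F n n n) W
      (((Equiv.refl (Fin n × Fin n)).prodCongr e) a) (((Equiv.refl (Fin n × Fin n)).prodCongr e) b)
      ((Equiv.refl ((Fin n × Fin n) × (Fin n × Fin n))) c)) =
      kroneckerTensor (matMulTensor F n n n) (matMulTensor F 1 n n) := by
    funext a b c
    simp only [kroneckerTensor_apply, Equiv.prodCongr_apply, Prod.map_fst, Prod.map_snd,
      Equiv.coe_refl, id_eq, W, Equiv.symm_apply_apply]
  rw [e₂] at h₂
  rw [h₂]
  exact tensorRank_kronecker_le_tensorRankD_tetra n W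

/-! ## The ceiling of collapse certificates: `R(⟨n,n,n⟩ ⊠ W) ≤ R(⟨n,n,n⟩) · n²` -/

/-- **Collapse ceiling.** `R(⟨n,n,n⟩ ⊠ W) ≤ R(⟨n,n,n⟩) · R(W) ≤ R(⟨n,n,n⟩) · n²` for every weight
`W : [n] × [n] × ([n] × Z)` (`Z` finite): rank is submultiplicative under `⊠` (Bläser 2013,
Lemma 5.8) and `R(W) ≤ n · n` by slicing along the third factor (Bläser 2013, §4).  In exponents:
a collapse certificate certifies at most `ω(K₄) ≥ ω + 2`, i.e. the residual `TetraPlusTwo` is the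
statement that the collapse ceiling is attained. [cite: Blaser2013, Lemma 5.8 and §4] -/
theorem tensorRank_kronecker_le_ceiling (n : ℕ) {Z : Type*} [Fintype Z] [DecidableEq Z]
    (W : Fin n → Fin n → Fin n × Z → F) :
    tensorRank (kroneckerTensor (matMulTensor F n n n) W) ≤
      tensorRank (matMulTensor F n n n) * (n * n) := by
  classical
  refine (Blaser2013_lemma58 _ _).trans (Nat.mul_le_mul_left _ ?_)
  simpa [Fintype.card_fin] using tensorRank_le_card_mul_card₁₂ W

/-- **The collapse window** `R(⟨n,n,n⟩ ⊠ W) ≤ min (R₄(T(K₄)_n), R(⟨n,n,n⟩) · n²)`: every collapse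
certificate lies below both the tetrahedron and the `ω + 2` ceiling. [folklore] -/
theorem tensorRank_kronecker_le_min (n : ℕ) {Z : Type*} [Fintype Z] [DecidableEq Z]
    (W : Fin n → Fin n → Fin n × Z → F) :
    tensorRank (kroneckerTensor (matMulTensor F n n n) W) ≤
      min (tensorRankD (tetra F n)) (tensorRank (matMulTensor F n n n) * (n * n)) :=
  le_min (tensorRank_kronecker_le_tensorRankD_tetra n W) (tensorRank_kronecker_le_ceiling n W)

end Collapse

/-! ## Exponents: collapse certificates lie below `min (ω(K₄), ω + 2)`; saturation gives the residual -/

section Exponent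

variable (F : Type) [Field F]

open Filter Asymptotics

/-- **Collapse-certified exponents**: `β` such that some choice of weights `W_n` (image index set of
size `≤ n³`, which is all a linear map on a leg of dimension `n³` can use) makes
`n^β = O(R(⟨n,n,n⟩ ⊠ W_n))`. -/
def collapseExponents : Set ℝ :=
  {β : ℝ | ∃ W : (n : ℕ) → Fin n → Fin n → Fin n × Fin (n ^ 3) → F,
    (fun n : ℕ => (n : ℝ) ^ β) =O[atTop]
      fun n : ℕ => (tensorRank (kroneckerTensor (matMulTensor F n n n) (W n)) : ℝ)}

variable {F} in
/-- Comparison of exponents from a big-O bound between powers of `n`. [folklore] -/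
theorem rpow_exponent_le_of_isBigO {β γ : ℝ}
    (h : (fun n : ℕ => (n : ℝ) ^ β) =O[atTop] fun n : ℕ => (n : ℝ) ^ γ) : β ≤ γ := by
  by_contra hlt
  rw [not_le] at hlt
  obtain ⟨C, hC⟩ := isBigO_iff.1 h
  have hev : ∀ᶠ n : ℕ in atTop, (n : ℝ) ^ (β - γ) ≤ C := by
    filter_upwards [hC, eventually_gt_atTop 0] with n hn hn0
    have hn0' : (0 : ℝ) < n := Nat.cast_pos.2 hn0
    rw [Real.norm_of_nonneg (Real.rpow_nonneg (Nat.cast_nonneg _) _),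
      Real.norm_of_nonneg (Real.rpow_nonneg (Nat.cast_nonneg _) _)] at hn
    rw [Real.rpow_sub hn0', div_le_iff₀ (Real.rpow_pos_of_pos hn0' _)]
    exact hn
  have hlim : Tendsto (fun n : ℕ => (n : ℝ) ^ (β - γ)) atTop atTop :=
    (tendsto_rpow_atTop (by linarith)).comp tendsto_natCast_atTop_atTop
  obtain ⟨n, hn₁, hn₂⟩ := (hev.and (hlim.eventually_gt_atTop C)).exists
  exact absurd hn₁ (not_le.2 hn₂)

/-- **Collapse certificates are tetrahedron lower bounds**: `β ≤ ω(K₄)` for every collapse-certified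
`β` (universal restriction). [folklore] -/
theorem le_omegaTetra_of_mem_collapseExponents {β : ℝ} (hβ : β ∈ collapseExponents F) :
    β ≤ omegaTetra F := by
  obtain ⟨W, hW⟩ := hβ
  refine le_csInf (tetraAdmissibleExponents_nonempty F) fun γ hγ => ?_
  refine rpow_exponent_le_of_isBigO (hW.trans (IsBigO.trans ?_ hγ))
  refine IsBigO.of_bound 1 (Eventually.of_forall fun n => ?_)
  rw [one_mul, Real.norm_of_nonneg (Nat.cast_nonneg _), Real.norm_of_nonneg (Nat.cast_nonneg _)]
  exact_mod_cast tensorRank_kronecker_le_tensorRankD_tetra n (W n)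

/-- **Collapse certificates certify at most `ω + 2`**: `β ≤ ω + 2` for every collapse-certified `β`
(the ceiling `R(⟨n,n,n⟩ ⊠ W) ≤ R(⟨n,n,n⟩) · n²`). [cite: Blaser2013, Lemma 5.8 and §4] -/
theorem le_omega_add_two_of_mem_collapseExponents {β : ℝ} (hβ : β ∈ collapseExponents F) :
    β ≤ omega F + 2 := by
  obtain ⟨W, hW⟩ := hβ
  suffices h : ∀ γ ∈ admissibleExponents F, β ≤ γ + 2 by
    have h' : β - 2 ≤ omega F :=
      le_csInf (admissibleExponents_nonempty F) fun γ hγ => by linarith [h γ hγ]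
    linarith
  intro γ hγ
  refine rpow_exponent_le_of_isBigO (hW.trans ?_)
  have h₁ : (fun n : ℕ => (tensorRank (kroneckerTensor (matMulTensor F n n n) (W n)) : ℝ))
      =O[atTop] fun n : ℕ => (tensorRank (matMulTensor F n n n) : ℝ) * (n : ℝ) ^ (2 : ℝ) := by
    refine IsBigO.of_bound 1 (Eventually.of_forall fun n => ?_)
    rw [one_mul, Real.norm_of_nonneg (Nat.cast_nonneg _), Real.norm_of_nonneg
      (mul_nonneg (Nat.cast_nonneg _) (Real.rpow_nonneg (Nat.cast_nonneg _) _))]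
    calc (tensorRank (kroneckerTensor (matMulTensor F n n n) (W n)) : ℝ)
        ≤ (tensorRank (matMulTensor F n n n) * (n * n) : ℕ) := by
          exact_mod_cast tensorRank_kronecker_le_ceiling n (W n)
      _ = (tensorRank (matMulTensor F n n n) : ℝ) * (n : ℝ) ^ (2 : ℝ) := by
          rw [show (2 : ℝ) = (2 : ℕ) by norm_num, Real.rpow_natCast]
          push_cast
          ring
  refine h₁.trans ((hγ.mul (isBigO_refl (fun n : ℕ => (n : ℝ) ^ (2 : ℝ)) atTop)).trans ?_)
  refine IsBigO.of_bound 1 ?_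
  filter_upwards [eventually_gt_atTop 0] with n hn
  have hn' : (0 : ℝ) < n := Nat.cast_pos.2 hn
  rw [one_mul, Real.norm_of_nonneg (mul_nonneg (Real.rpow_nonneg hn'.le _) (Real.rpow_nonneg hn'.le _)),
    Real.norm_of_nonneg (Real.rpow_nonneg hn'.le _), ← Real.rpow_add hn']

/-- **The collapse window in exponents**: every collapse-certified exponent lies below
`min (ω(K₄), ω + 2)`. [folklore] -/
theorem le_min_of_mem_collapseExponents {β : ℝ} (hβ : β ∈ collapseExponents F) :
    β ≤ min (omegaTetra F) (omega F + 2) :=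
  le_min (le_omegaTetra_of_mem_collapseExponents F hβ) (le_omega_add_two_of_mem_collapseExponents F hβ)

/-- **Saturation gives the residual**: if collapse certificates come arbitrarily close to their
ceiling `ω + 2`, then `ω + 2 ≤ ω(K₄)`. [folklore] -/
theorem omega_add_two_le_omegaTetra_of_saturation
    (h : ∀ ε > (0 : ℝ), ∃ β ∈ collapseExponents F, omega F + 2 - ε ≤ β) :
    omega F + 2 ≤ omegaTetra F := by
  by_contra hlt
  rw [not_le] at hlt
  obtain ⟨β, hβ, hle⟩ := h ((omega F + 2 - omegaTetra F) / 2) (by linarith)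
  have := le_omegaTetra_of_mem_collapseExponents F hβ
  linarith

/-- **Door D2 beneath the residual of the cut of record**: collapse saturation over `ℂ` implies
`TetraPlusTwo : ω + 2 ≤ ω(K₄)` (item 27058) BY NAME. [folklore] -/
theorem tetraPlusTwo_of_collapseSaturation
    (h : ∀ ε > (0 : ℝ), ∃ β ∈ collapseExponents ℂ, omega ℂ + 2 - ε ≤ β) :
    Summit.MatrixMultiplication.MatrixMultiplication.Theses.TetrahedronCarving.TetraPlusTwo :=
  omega_add_two_le_omegaTetra_of_saturation ℂ h

end Exponent

end Summit.MatrixMultiplication.MatrixMultiplication.Theorems.TetrahedronTensor
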